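import Mathlib
import Summits.MatrixMultiplication.MatrixMultiplication.Theorems.SnSubsetDichotomyPolynomialSlackHubAtomOfArea
import Summits.MatrixMultiplication.MatrixMultiplication.Theorems.SnSubsetDichotomyPolynomialSlackPinnedBlock
import Summits.MatrixMultiplication.MatrixMultiplication.Theorems.SnSubsetDichotomyPolynomialSlackDepletedArea

/-!
# No-win consequences for atoms

Crux `Summit.MatrixMultiplication.MatrixMultiplication.Theses.SnSubsetDichotomy.PolynomialSlack`
(item `stmt-MatrixMultiplication-8306`), level-one programme, line transport-split-hull (lead c9,
all-split endgame, stub group "AtomWins").  For a TPP triple `S, T, U ⊆ S_n` of non-empty sets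
with volume `N = |S||T||U|`, quotient profiles `d_A, d_B, d_C`, a hub position `k` of `U` and a
flat atom `I × J`, the one-dense endgame argues by contradiction: it assumes that `N` exceeds each
of the three "win" bounds — the hub atom of small area (`volume_le_of_hub_atom_of_area`), the
depleted flat atom (`volume_le_of_depleted_flat_atom`) and the pinned block
(`volume_le_of_pinned_block_S`, `volume_le_of_pinned_block_T`) — and consumes the contrapositive
consequences in the per-position inequality.  This file records exactly these wrappers:

* `hits_gt_of_noWin_hubArea` — an excluded small hub pair is strongly anti-depleted: its forced
  hits exceed `(1 + M)σρ/n`;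
* `hubMass_lt_of_noWin_depleted` — a depleted flat atom carries hub mass `< h₁`;
* `card_sq_gt_of_noWin_T`, `card_sq_gt_of_noWin_S` — a block of hub mass `≥ σ` (resp. `≥ ρ`) is
  unpinned, `Pσ² < |J|²` (resp. `Pρ² < |I|²`), as soon as `N > nPB`;
* `area_max_le_of_depleted` — a depleted flat pair has small area, in the `max (card, 1)` form
  `max(|J|,1)·max(|I|,1) ≤ A₀`, whenever `A₀` dominates `n` and the depleted-area bound of
  `area_le_of_depleted_flat_block`.
-/

namespace Summit.MatrixMultiplication.MatrixMultiplication.Theorems.PolynomialSlack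

set_option linter.dupNamespace false

open scoped BigOperators
open Literature.Combinatorics.Additive (TripleProductProperty)

/-- **No small-area hub win ⇒ strong anti-depletion.** In the setting of
`volume_le_of_hub_atom_of_area` (TPP triple `S, T, U ⊆ S_n`, `n ≥ 2`, hub position `k`, flat atom
`I × J` with `β ≤ d_B(j,k) ≤ 2β` on `J`, `γ ≤ d_C(k,i) ≤ 2γ` on `I`, `β, γ ≥ 16/n`, hub mass
`Σ_v μXY ≥ h₁ > 0`, area `|I||J| ≤ A`, `M ≥ 0`), if the volume `|S||T||U|` strictly exceeds the
win bound `20(1+M)A²B/(h₁²n)` then the forced hits of the atom strictly exceed `(1+M)×` neutral: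
`(1+M)σρ/n < Σ_{I×J} d_A p_B p_C`.  Proof: otherwise `volume_le_of_hub_atom_of_area` applies. -/
theorem hits_gt_of_noWin_hubArea {n : ℕ} (hn : 2 ≤ n) (B : ℕ)
    (hB : ∀ S' T' U' : Finset (Equiv.Perm (Fin (n - 1))), TripleProductProperty S' T' U' →
      S'.card * T'.card * U'.card ≤ B)
    {S T U : Finset (Equiv.Perm (Fin n))} (hTPP : TripleProductProperty S T U)
    (hS0 : S.Nonempty) (hT0 : T.Nonempty) (hU0 : U.Nonempty) (dA dB dC : Fin n → Fin n → ℝ)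
    (hdA : ∀ i j, dA i j =
      (((S ×ˢ T).filter fun st => st.2 j = st.1 i).card : ℝ) / (S.card * T.card : ℕ))
    (hdB : ∀ j k, dB j k =
      (((T ×ˢ U).filter fun tu => tu.2 k = tu.1 j).card : ℝ) / (T.card * U.card : ℕ))
    (hdC : ∀ k i, dC k i =
      (((U ×ˢ S).filter fun us => us.2 i = us.1 k).card : ℝ) / (U.card * S.card : ℕ))
    (k : Fin n) (J I : Finset (Fin n)) (β γ M h₁ A : ℝ) (hβ : 16 / (n : ℝ) ≤ β)
    (hγ : 16 / (n : ℝ) ≤ γ) (hM : 0 ≤ M) (hh₁ : 0 < h₁)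
    (hJ : ∀ j ∈ J, β ≤ dB j k ∧ dB j k ≤ 2 * β) (hI : ∀ i ∈ I, γ ≤ dC k i ∧ dC k i ≤ 2 * γ)
    (hhub : h₁ ≤ ∑ v : Fin n, ((U.filter fun u => u k = v).card : ℝ) / U.card *
      ((((T.filter fun t => t⁻¹ v ∈ J).card : ℝ) / T.card) *
        (((S.filter fun s => s⁻¹ v ∈ I).card : ℝ) / S.card)))
    (harea : (I.card : ℝ) * J.card ≤ A)
    (hN : 20 * (1 + M) * A ^ 2 * B / (h₁ ^ 2 * n) < ((S.card * T.card * U.card : ℕ) : ℝ)) :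
    (1 + M) * ((∑ j ∈ J, (dB j k - 1 / n)) * (∑ i ∈ I, (dC k i - 1 / n))) / n <
      ∑ i ∈ I, ∑ j ∈ J, dA i j * (dB j k - 1 / n) * (dC k i - 1 / n) := by
  exact not_le.1 fun hle => absurd hN (not_lt.2 (volume_le_of_hub_atom_of_area hn B hB hTPP hS0
    hT0 hU0 dA dB dC hdA hdB hdC k J I β γ M h₁ A hβ hγ hM hh₁ hJ hI hhub harea hle))

/-- **No depleted-atom win ⇒ no depleted hub pair.** In the setting of
`volume_le_of_depleted_flat_atom` (TPP triple `S, T, U ⊆ S_n`, `n ≥ 2`, hub position `k`, flat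
atom `I × J` with `β, γ ≥ 16/n`, depletion `Σ_{I×J} d_A p_B p_C ≤ (1-ε)σρ/n`, `0 < ε ≤ 1`,
`h₁ > 0`), if the volume `|S||T||U|` strictly exceeds the win bound
`10⁷ (1 + log n)² (log (4K/ε))² n B/(ε⁴ h₁²)` (`K = n!/(|S||T|)`) then the atom carries hub mass
`Σ_v μXY < h₁`.  Proof: otherwise `volume_le_of_depleted_flat_atom` applies with `h = h₁`. -/
theorem hubMass_lt_of_noWin_depleted {n : ℕ} (hn : 2 ≤ n) (B : ℕ)
    (hB : ∀ S' T' U' : Finset (Equiv.Perm (Fin (n - 1))), TripleProductProperty S' T' U' →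
      S'.card * T'.card * U'.card ≤ B)
    {S T U : Finset (Equiv.Perm (Fin n))} (hTPP : TripleProductProperty S T U)
    (hS0 : S.Nonempty) (hT0 : T.Nonempty) (hU0 : U.Nonempty) (dA dB dC : Fin n → Fin n → ℝ)
    (hdA : ∀ i j, dA i j =
      (((S ×ˢ T).filter fun st => st.2 j = st.1 i).card : ℝ) / (S.card * T.card : ℕ))
    (hdB : ∀ j k, dB j k =
      (((T ×ˢ U).filter fun tu => tu.2 k = tu.1 j).card : ℝ) / (T.card * U.card : ℕ))
    (hdC : ∀ k i, dC k i =
      (((U ×ˢ S).filter fun us => us.2 i = us.1 k).card : ℝ) / (U.card * S.card : ℕ))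
    (k : Fin n) (J I : Finset (Fin n)) (β γ ε h₁ : ℝ) (hβ : 16 / (n : ℝ) ≤ β)
    (hγ : 16 / (n : ℝ) ≤ γ) (hε : 0 < ε) (hε1 : ε ≤ 1) (hh₁ : 0 < h₁)
    (hJ : ∀ j ∈ J, β ≤ dB j k ∧ dB j k ≤ 2 * β) (hI : ∀ i ∈ I, γ ≤ dC k i ∧ dC k i ≤ 2 * γ)
    (hdep : ∑ i ∈ I, ∑ j ∈ J, dA i j * (dB j k - 1 / n) * (dC k i - 1 / n) ≤
      (1 - ε) * ((∑ j ∈ J, (dB j k - 1 / n)) * (∑ i ∈ I, (dC k i - 1 / n))) / n)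
    (hN : 10 ^ 7 * (1 + Real.log n) ^ 2 *
      (Real.log (4 * ((n.factorial : ℝ) / (S.card * T.card : ℕ)) / ε)) ^ 2 * n * B /
        (ε ^ 4 * h₁ ^ 2) < ((S.card * T.card * U.card : ℕ) : ℝ)) :
    ∑ v : Fin n, ((U.filter fun u => u k = v).card : ℝ) / U.card *
      ((((T.filter fun t => t⁻¹ v ∈ J).card : ℝ) / T.card) *
        (((S.filter fun s => s⁻¹ v ∈ I).card : ℝ) / S.card)) < h₁ := by
  exact not_le.1 fun hle => absurd hN (not_lt.2 (volume_le_of_depleted_flat_atom hn B hB hTPP hS0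
    hT0 hU0 dA dB dC hdA hdB hdC k J I β γ ε h₁ hβ hγ hε hε1 hh₁ hJ hI hle hdep))

/-- **No pinned-block win ⇒ substantial `T`-blocks are unpinned.** For a TPP triple
`S, T, U ⊆ S_n` with `T, U` non-empty, a hub position `k` of `U`, a block `J` of `T`-bump columns of
hub mass `Σ_v μ(v)X(v) ≥ σ > 0` and a parameter `P ≥ 0`: if the volume `|S||T||U|` strictly
exceeds `n P B`, then `P σ² < |J|²`.  Proof: otherwise `|J|² ≤ Pσ²` and the pinned-block bound
`volume_le_of_pinned_block_T`, `|S||T||U| ≤ n|J|²B/σ² ≤ nPB`, contradicts the hypothesis. -/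
theorem card_sq_gt_of_noWin_T {n : ℕ} (B : ℕ)
    (hB : ∀ S' T' U' : Finset (Equiv.Perm (Fin (n - 1))), TripleProductProperty S' T' U' →
      S'.card * T'.card * U'.card ≤ B)
    {S T U : Finset (Equiv.Perm (Fin n))} (hTPP : TripleProductProperty S T U) (hT0 : T.Nonempty)
    (hU0 : U.Nonempty) (k : Fin n) (J : Finset (Fin n)) (σ P : ℝ) (hσ : 0 < σ) (hP : 0 ≤ P)
    (hmass : σ ≤ ∑ v : Fin n, ((U.filter fun u => u k = v).card : ℝ) / U.card *
      (((T.filter fun t => t⁻¹ v ∈ J).card : ℝ) / T.card))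
    (hN : (n : ℝ) * P * B < ((S.card * T.card * U.card : ℕ) : ℝ)) :
    P * σ ^ 2 < (J.card : ℝ) ^ 2 := by
  -- `P ≥ 0` is not needed: for `P < 0` the claim is trivial, and the proof below is uniform
  have _ := hP
  refine not_le.1 fun hle => absurd hN (not_lt.2 ?_)
  refine (volume_le_of_pinned_block_T B hB hTPP hT0 hU0 k J σ hσ hmass).trans ?_
  rw [div_le_iff₀ (by positivity : (0 : ℝ) < σ ^ 2)]
  calc (n : ℝ) * (J.card : ℝ) ^ 2 * B ≤ n * (P * σ ^ 2) * B := by gcongr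
    _ = n * P * B * σ ^ 2 := by ring

/-- **No pinned-block win ⇒ substantial `S`-blocks are unpinned.** For a TPP triple
`S, T, U ⊆ S_n` with `S, U` non-empty, a hub position `k` of `U`, a block `I` of `S`-bump rows of
hub mass `Σ_v μ(v)Y(v) ≥ ρ > 0` and a parameter `P ≥ 0`: if the volume `|S||T||U|` strictly
exceeds `n P B`, then `P ρ² < |I|²`.  Proof: otherwise `|I|² ≤ Pρ²` and the pinned-block bound
`volume_le_of_pinned_block_S`, `|S||T||U| ≤ n|I|²B/ρ² ≤ nPB`, contradicts the hypothesis. -/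
theorem card_sq_gt_of_noWin_S {n : ℕ} (B : ℕ)
    (hB : ∀ S' T' U' : Finset (Equiv.Perm (Fin (n - 1))), TripleProductProperty S' T' U' →
      S'.card * T'.card * U'.card ≤ B)
    {S T U : Finset (Equiv.Perm (Fin n))} (hTPP : TripleProductProperty S T U) (hS0 : S.Nonempty)
    (hU0 : U.Nonempty) (k : Fin n) (I : Finset (Fin n)) (ρ P : ℝ) (hρ : 0 < ρ) (hP : 0 ≤ P)
    (hmass : ρ ≤ ∑ v : Fin n, ((U.filter fun u => u k = v).card : ℝ) / U.card *
      (((S.filter fun s => s⁻¹ v ∈ I).card : ℝ) / S.card))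
    (hN : (n : ℝ) * P * B < ((S.card * T.card * U.card : ℕ) : ℝ)) :
    P * ρ ^ 2 < (I.card : ℝ) ^ 2 := by
  -- `P ≥ 0` is not needed: for `P < 0` the claim is trivial, and the proof below is uniform
  have _ := hP
  refine not_le.1 fun hle => absurd hN (not_lt.2 ?_)
  refine (volume_le_of_pinned_block_S B hB hTPP hS0 hU0 k I ρ hρ hmass).trans ?_
  rw [div_le_iff₀ (by positivity : (0 : ℝ) < ρ ^ 2)]
  calc (n : ℝ) * (I.card : ℝ) ^ 2 * B ≤ n * (P * ρ ^ 2) * B := by gcongr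
    _ = n * P * B * ρ ^ 2 := by ring

/-- **Depleted pairs have small area (`max (card, 1)` form).** For non-empty `S, T ⊆ S_n`
(`n ≥ 2`) with injective quotient map, quotient profile `d_A`, a pair `I × J` with weights
`β ≤ p ≤ 4β` on `J`, `γ ≤ q ≤ 4γ` on `I` (`β, γ > 0`), depleted in the sense
`Σ_{I×J} d_A p q ≤ (1-ε)(Σ_J p)(Σ_I q)/n` (`0 < ε ≤ 1`), and any `A₀` with
`5000 n (1 + log n) log(4K/ε)/ε² ≤ A₀` (`K = n!/(|S||T|)`) and `n ≤ A₀`, one has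
`max(|J|,1) · max(|I|,1) ≤ A₀`.  Proof: if `J = ∅` (or `I = ∅`) the product is
`max(|I|,1) ≤ n ≤ A₀` (resp. `max(|J|,1) ≤ n`); otherwise both maxima are the cardinalities and
`|I||J| ≤ 5000 n (1 + log n) log(4K/ε)/ε² ≤ A₀` by `area_le_of_depleted_flat_block`. -/
theorem area_max_le_of_depleted {n : ℕ} (hn : 2 ≤ n) (S T : Finset (Equiv.Perm (Fin n)))
    (hS0 : S.Nonempty) (hT0 : T.Nonempty)
    (hinj : Set.InjOn (fun st : Equiv.Perm (Fin n) × Equiv.Perm (Fin n) => st.1⁻¹ * st.2)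
      (↑S ×ˢ ↑T : Set (Equiv.Perm (Fin n) × Equiv.Perm (Fin n))))
    (dA : Fin n → Fin n → ℝ)
    (hdA : ∀ i j, dA i j =
      (((S ×ˢ T).filter fun st => st.2 j = st.1 i).card : ℝ) / (S.card * T.card : ℕ))
    (I J : Finset (Fin n)) (p q : Fin n → ℝ) (β γ ε A₀ : ℝ) (hβ : 0 < β) (hγ : 0 < γ) (hε : 0 < ε)
    (hε1 : ε ≤ 1) (hp : ∀ j ∈ J, β ≤ p j ∧ p j ≤ 4 * β) (hq : ∀ i ∈ I, γ ≤ q i ∧ q i ≤ 4 * γ)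
    (hdep : ∑ i ∈ I, ∑ j ∈ J, dA i j * p j * q i ≤
      (1 - ε) * ((∑ j ∈ J, p j) * (∑ i ∈ I, q i)) / n)
    (hA₀ : 5000 * n * (1 + Real.log n) *
      Real.log (4 * ((n.factorial : ℝ) / (S.card * T.card : ℕ)) / ε) / ε ^ 2 ≤ A₀)
    (hA₀n : (n : ℝ) ≤ A₀) : max (J.card : ℝ) 1 * max (I.card : ℝ) 1 ≤ A₀ := by
  have hn1 : 1 ≤ n := le_trans one_le_two hn
  have hnR1 : (1 : ℝ) ≤ n := by exact_mod_cast hn1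
  -- both cardinalities are at most `n = |Fin n|`
  have hIn : (I.card : ℝ) ≤ n := by
    have h := Finset.card_le_univ I
    rw [Fintype.card_fin] at h
    exact_mod_cast h
  have hJn : (J.card : ℝ) ≤ n := by
    have h := Finset.card_le_univ J
    rw [Fintype.card_fin] at h
    exact_mod_cast h
  have hImax : max (I.card : ℝ) 1 ≤ n := max_le hIn hnR1
  have hJmax : max (J.card : ℝ) 1 ≤ n := max_le hJn hnR1
  -- degenerate pairs: one factor is `1`, the other is at most `n ≤ A₀`
  rcases J.eq_empty_or_nonempty with hJe | hJne
  · rw [hJe, Finset.card_empty, Nat.cast_zero, max_eq_right (zero_le_one' ℝ), one_mul]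
    exact hImax.trans hA₀n
  rcases I.eq_empty_or_nonempty with hIe | hIne
  · rw [hIe, Finset.card_empty, Nat.cast_zero, max_eq_right (zero_le_one' ℝ), mul_one]
    exact hJmax.trans hA₀n
  -- genuine pairs: the depleted-area bound
  have hJ1 : (1 : ℝ) ≤ J.card := by exact_mod_cast Finset.one_le_card.2 hJne
  have hI1 : (1 : ℝ) ≤ I.card := by exact_mod_cast Finset.one_le_card.2 hIne
  rw [max_eq_left hJ1, max_eq_left hI1]
  have harea := area_le_of_depleted_flat_block hn1 S T hS0 hT0 hinj dA hdA I J p q β γ ε hβ hγ hε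
    hε1 hp hq hdep
  calc (J.card : ℝ) * I.card = ((I.card * J.card : ℕ) : ℝ) := by push_cast; ring
    _ ≤ _ := harea
    _ ≤ A₀ := hA₀

end Summit.MatrixMultiplication.MatrixMultiplication.Theorems.PolynomialSlack
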